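import Literature.Geometry.Kaehler.CyclotomicDegreeLeTwelveHodgeConjecture
import Literature.Geometry.Kaehler.ComplexTorusCyclotomicAutomorphismOrderSixteenHodge
import Literature.AlgebraicGeometry.ComplexMultiplication.CyclotomicCMTypeCensusTwentyOne
import Literature.AlgebraicGeometry.Pohlmann1968.CyclotomicCosetBalancedCMTypes
import Literature.AlgebraicGeometry.Pohlmann1968.DegenerateCMTypeCyclotomic21
import HarnessLib

/-!
# `ℚ(ζ₂₁) = ℚ(ζ₃, ζ₇)`: the ranks `7, 7, 6, 6` of the primitive CM types, the Hodge conjecture for all powers of the abelian varieties of the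
# `40` types OFF Dodson's two degenerate families, simple CM SIXFOLDS WITH `B³ ≠ D³` for the `24` types ON them, and the complex `6`-tori
# with an endomorphism of characteristic polynomial `Φ₂₁`

Layer `Literature/Geometry/Kaehler`, namespace `Literature.Geometry.Kaehler.ComplexTorus`; lane `lit-hodgefound` (Track 2 foundations
library), prover seat `lit-hodgefound-p10`, generation 34, row «A2-26 (ℚ(ζ₂₁) Hodge)» (self-proposed 2026-08-28).  Theorems only; no `def`, no
instance, no named fact (net Literature debt 0).  This is one of the four fields EXCLUDED from generation 33's closing statement
`CyclotomicDegreeLeTwelveHodgeConjecture` (`d ∉ {21, 28, 36, 42}`): here degenerate primitive types DO occur, and the file says exactly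
which, and what happens on them.

INPUT: the census `CyclotomicCMTypeCensusTwentyOne` (eight families; representatives `P₁ = {1, 2, 4, 5, 8, 11}`, `P₂ = {1, 2, 4, 10, 13, 16}`, `D₁ = {1, 2, 4, 5, 8, 10}`,
`D₂ = {1, 2, 5, 8, 10, 17}` of the four PRIMITIVE families; the order-`6` subgroups `W₁ = {1, 4, 10, 13, 16, 19}` (fixed field ℚ(√−3) = ℚ(ζ₃)) and
`W₂ = {1, 2, 4, 8, 11, 16}` (ℚ(√−7)); `D₁`, `D₂` coset-balanced for `W₁`, `W₂`) and `Pohlmann1968/CyclotomicCosetBalancedCMTypes` (Yanai ∕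
Mumford–Pohlmann on residues).

* §1 RANKS: `seven_le_cmTypeRank_of_residueSet_eq_P1/P2_twentyOne` (explicit `7 × 7` certificates), `six_le_…_D1/D2_twentyOne` (`6 × 6`),
  **`cmTypeRank_eq_seven_of_not_cosetBalanced_twentyOne`** ∕ **`cmTypeRank_eq_six_of_cosetBalanced_twentyOne`**: a PRIMITIVE type of `ℚ(ζ₂₁)` has rank
  `7 = n + 1` (NONDEGENERATE) unless its residue set is coset-balanced for `W₁` or `W₂`, in which case it has rank EXACTLY `6 = n`
  (Dodson's «converse of Ribet» types, `n − l + 2 = 6`; the index of degeneracy is `1`, Yanai's bound attained);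
  **`isNondegenerate_iff_twentyOne`** (nondegenerate ⟺ primitive ∧ not coset-balanced); `ncard_isNondegenerate_twentyOne` (`24` of the `64` types),
  `ncard_isPrimitive_and_cosetBalanced_twentyOne` (`24`).
* §2 VARIETIES `(A, ι, θ)` of type `(ℚ(ζ₂₁); Φ)` (all `dim A = 6`): **`hodgeClassSpan_pow_eq_divisorClassesSpan_of_not_cosetBalanced_twentyOne`**
  and **`hodgeConjectureFor_pow_of_not_cosetBalanced_twentyOne`** — `B•(Aⁿ) ⊗ ℂ = D•(Aⁿ) ⊗ ℂ` and the Hodge conjecture for ALL powers, for the `40`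
  types that are imprimitive (induced: degree-`≤ 12` theorem) or primitive non-coset-balanced (rank `7`); **`exists_exceptional_of_cosetBalanced_twentyOne`**
  — for the `24` PRIMITIVE COSET-BALANCED types EVERY realisation is a SIMPLE abelian sixfold carrying rational `(3,3)`-classes outside
  `D³(A) ⊗ ℂ` (at least two independent: the Weil classes of `(A, k)`, `k` = ℚ(√−3) = ℚ(ζ₃) resp. ℚ(√−7)), so `B³(A) ⊗ ℂ ≠ D³(A) ⊗ ℂ`
  (`hodgeClassSpan_three_ne_twentyOne`); the DICHOTOMY **`hodgeConjectureFor_pow_or_exceptional_twentyOne`** for every CM abelian variety by `ℚ(ζ₂₁)`;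
  non-vacuity `exists_isSimple_exceptional_twentyOne` (Shimura §6.2 Thm. 3).  The tree type `Φ₂₁` of `DegenerateCMTypeCyclotomic21` has residue set `D₁` (`residueSet_Φ₂₁`): its family is the `W₁`-family.
* §3 TORI: for every complex torus `X` (of dimension `6`) with an endomorphism `u` of characteristic polynomial `Φ₂₁`:
  **`IsSimple.mtRank_hodgeStructure_eq_seven_or_six_twentyOne`**, **`forall_divisorClasses_powPeriod_eq_hodgeClasses_iff_of_isSimple_twentyOne`**
  (`Hdg = Div` on ALL powers ⟺ `rank MT(X) = 7`, for simple `X`), `divisorClasses_powPeriod_eq_hodgeClasses_of_twentyOne` (non-simple `X`, or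
  rank `7`: `Hdg(Xᵏ) = Div(Xᵏ)` for all `k`), and BOTH CASES OCCUR among abelian varieties: `exists_isSimple_mtRank_eq_six_twentyOne` (a simple
  abelian `6`-fold `X = ℂ⁶/Φ(𝔞)` with `u = ζ₂₁`, `rank MT = 6`, and `Hdg(Xᵏ) ≠ Div(Xᵏ)` for some power) and `exists_isSimple_mtRank_eq_seven_twentyOne`.

HONEST SCOPE.  For the `24` coset-balanced primitive types the Hodge conjecture for `A` (algebraicity of the Weil classes in `H⁶`) is
NOT asserted here (open in print for these CM points, to the typist's knowledge); what is proved is `B³ ≠ D³` and the failure of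
«`Hdg = Div` on all powers».

## References

* [Dodson1984] B. Dodson, *The structure of Galois groups of CM-fields*, Trans. AMS 283 (1984), §3.1.0 (p. 11), Thm. 3.2.1 (p. 13).
* [Shimura1998] G. Shimura, *Abelian Varieties with Complex Multiplication and Modular Functions* (1998), §6.2 Thm. 3, §8.2 Prop. 26, §8.4.
* [Gordon1999HodgeAVSurvey] B. B. Gordon (1999), 5.13 (ii), Thm. 6.4, 7.5, 9.2.2, §9.3, 9.4.3 (Theorem [B.140], Yanai).
* [vanGeemen1994HodgeAV] B. van Geemen, LNM 1594 (1994), Thm. 4.5, 4.7.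
* [Pohlmann1968] H. Pohlmann, Ann. of Math. 88 (1968), Thm. 1, §3.
* [Kubota1965] T. Kubota, Trans. AMS 118 (1965), §2 p. 115.
* [MoonenZarhin1999LowDim] B. Moonen, Yu. Zarhin, Math. Ann. 315 (1999), §2 (2.7).
-/

noncomputable section

open scoped Classical nonZeroDivisors NumberField Manifold ContDiff MatrixGroups
open NumberField Module Polynomial CategoryTheory CategoryTheory.Limits

namespace Literature.Geometry.Kaehler

namespace ComplexTorus

-- `open scoped`: the tree's action of `Aut(ℂ)` on `Hom(K, ℂ)` by composition (`ringEquivCompAction`) is a scoped instance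
open scoped Literature.NumberTheory.ComplexMultiplication
open Literature.NumberTheory.Automorphic (IsTorusSubgroup)
open Literature.AlgebraicGeometry.Motives (CMType AbelianVariety HodgeTensorFacts hodgeTensorFacts_holds)
open Literature.AlgebraicGeometry.HodgeTheory (HodgeConjectureFor complexBetti IsRationalClass IsOfHodgeType)
open Literature.AlgebraicGeometry.VanGeemen1994 (hodgeClassSpan)
open Literature.Barriers.HodgeConjecture (divisorClassesSpan)
open Literature.NumberTheory.ComplexMultiplication (IsPrimitive translateInd translateInd_of_mem translateInd_of_not_mem)
open Literature.NumberTheory.ComplexMultiplication.CMTypeLattice (periodIso basisIndex card_basisIndex_eq_finrank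
  isSimple_periodIso_iff_isPrimitive isAbelianVariety_periodIso)
open Literature.AlgebraicGeometry.Pohlmann1968 (cmTypeRank cmTypeRank_le IsNondegenerate isNondegenerate_iff
  hodgeClassSpan_pow_eq_divisorClassesSpan_of_not_isPrimitive_of_finrank_le_twelve
  hodgeConjectureFor_pow_of_not_isPrimitive_of_finrank_le_twelve)
open Literature.AlgebraicGeometry.Pohlmann1968.Cyclotomic (autExp expOf exists_autExp_eq exists_expOf_eq finrank_eq_totient
  not_isNondegenerate_of_cosetBalanced cmTypeRank_le_of_cosetBalanced exists_exceptional_of_cosetBalanced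
  two_le_finrank_hodgeClassSpan_sub_finrank_divisorClassesSpan_of_cosetBalanced cosetBalanced_of_isAutTransform)
open Literature.AlgebraicGeometry.ComplexMultiplication (IsCMTypeRealisation isSimple_iff_isPrimitive
  isSimple_of_isCMTypeRealisation_of_isPrimitive)
open Literature.AlgebraicGeometry.ComplexMultiplication.CMTorus (mtRank_hodgeStructure_periodIso_eq_cmTypeRank)
open Literature.AlgebraicGeometry.ComplexMultiplication.CyclotomicCMTypeResidueSets (IsAutTransform IsAutTransform.symm unitResidues
  residueSet HasTrivialStabilizer allCMResidueSets expOf_smul expOf_mem_residueSet_iff IsAutTransform.isPrimitive_iff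
  isPrimitive_iff_hasTrivialStabilizer coprime_iff_mem_unitResidues isCMResidueSet_residueSet card_filter_allCMResidueSets_eq
  ncard_setOf_eq_card_filter_powerset_half)
open Literature.AlgebraicGeometry.ComplexMultiplication.CyclotomicCMTypeCensusTwentyOne (isCMResidueSet_half_twentyOne isCMResidueSet_reps_twentyOne
  stabilizer_reps_twentyOne subgroups_order_six_twentyOne cosetBalanced_D_twentyOne not_cosetBalanced_P_twentyOne exists_isAutTransform_of_isPrimitive_twentyOne
  exists_eight_families_twentyOne)

/-! ### §1 The ranks of the CM types of `ℚ(ζ₂₁)` -/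

section Types

variable {K : Type} [Field K] [NumberField K]

variable [IsCyclotomicExtension {21} ℚ K]

variable (K) in
/-- `ℚ(ζ₂₁)` is a CM field (Mathlib). No instance is registered. [folklore] -/
private theorem isCMField₆₀ : IsCMField K :=
  IsCyclotomicExtension.Rat.isCMField K (S := ({21} : Set ℕ)) ⟨21, rfl, by norm_num⟩

variable (K) in
/-- `[ℚ(ζ₂₁) : ℚ] = 12`. [folklore] -/
private theorem finrank_eq_twelve₆₀ : finrank ℚ K = 12 := by
  rw [IsCyclotomicExtension.Rat.finrank 21 K]; decide

/-- The indicator of a translate of `Φ`, read on exponents. [cite: Shimura1998, §8.4 Example (1)] -/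
private theorem translateInd_eq_ite₆₀ (Φ : CMType K) (τ : ℂ ≃+* ℂ) (σ : K →+* ℂ) :
    translateInd Φ.1 τ σ = if autExp 21 τ * expOf 21 K σ ∈ residueSet 21 Φ then (1 : ℚ) else 0 := by
  have h : τ • σ ∈ Φ.1 ↔ autExp 21 τ * expOf 21 K σ ∈ residueSet 21 Φ := by
    rw [← expOf_mem_residueSet_iff 21 Φ, expOf_smul]
  by_cases hm : autExp 21 τ * expOf 21 K σ ∈ residueSet 21 Φ
  · rw [translateInd_of_mem (h.2 hm), if_pos hm]
  · rw [translateInd_of_not_mem (fun h' => hm (h.1 h')), if_neg hm]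

/-- **`Rank(Φ) ≥ 7` for the type with residue set `{1, 2, 4, 5, 8, 11}`** (`= P1`): the translates by the automorphisms of `ℂ` with cyclotomic
characters `1, 2, 4, 5, 8, 10, 11`, read at the embeddings with exponents `1, 2, 4, 5, 8, 10, 11`, are linearly independent (the `7 × 7` matrix `([u·c ∈ S])`
is invertible). [cite: Dodson1984, §3.1.0 (p. 11)] [cite: Kubota1965, §2 (p. 115)] -/
theorem seven_le_cmTypeRank_of_residueSet_eq_P1_twentyOne (Φ : CMType K) (hΦ : residueSet 21 Φ = {1, 2, 4, 5, 8, 11}) :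
    7 ≤ cmTypeRank Φ := by
  classical
  have hu : ∀ i : Fin 7, ((![1, 2, 4, 5, 8, 10, 11] : Fin 7 → ZMod 21) i).val.Coprime 21 := by decide
  have hc : ∀ j : Fin 7, ((![1, 2, 4, 5, 8, 10, 11] : Fin 7 → ZMod 21) j).val.Coprime 21 := by decide
  choose τ hτ using fun i : Fin 7 => exists_autExp_eq 21 _ (hu i)
  choose σ hσ using fun j : Fin 7 => exists_expOf_eq 21 K _ (hc j)
  let f : Fin 7 → (K →+* ℂ) → ℚ := fun i => translateInd Φ.1 (τ i)
  have hval : ∀ i j : Fin 7, f i (σ j) =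
      if (![1, 2, 4, 5, 8, 10, 11] : Fin 7 → ZMod 21) i * (![1, 2, 4, 5, 8, 10, 11] : Fin 7 → ZMod 21) j ∈
        ({1, 2, 4, 5, 8, 11} : Finset (ZMod 21)) then (1 : ℚ) else 0 := by
    intro i j
    show translateInd Φ.1 (τ i) (σ j) = _
    rw [translateInd_eq_ite₆₀, hτ, hσ, hΦ]
  have hli : LinearIndependent ℚ f := by
    rw [Fintype.linearIndependent_iff]
    intro g hg
    have heval : ∀ j : Fin 7, ∑ i, g i * f i (σ j) = 0 := fun j => by
      have := congrFun hg (σ j)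
      simpa only [Finset.sum_apply, Pi.smul_apply, smul_eq_mul, Pi.zero_apply] using this
    have e0 := heval 0
    have e1 := heval 1
    have e2 := heval 2
    have e3 := heval 3
    have e4 := heval 4
    have e5 := heval 5
    have e6 := heval 6
    simp (config := { decide := true }) [Fin.sum_univ_seven, hval] at e0 e1 e2 e3 e4 e5 e6
    intro i
    fin_cases i <;> simp <;> linarith
  have h1 : Module.finrank ℚ (Submodule.span ℚ (Set.range f)) = 7 := by
    rw [finrank_span_eq_card hli, Fintype.card_fin]
  have h2 : Submodule.span ℚ (Set.range f) ≤
      Submodule.span ℚ (Set.range fun g : ℂ ≃+* ℂ => translateInd Φ.1 g) :=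
    Submodule.span_mono (by rintro _ ⟨i, rfl⟩; exact ⟨τ i, rfl⟩)
  have h3 := Submodule.finrank_mono h2
  rw [h1] at h3
  exact h3

/-- **`Rank(Φ) ≥ 7` for the type with residue set `{1, 2, 4, 10, 13, 16}`** (`= P2`): the translates by the automorphisms of `ℂ` with cyclotomic
characters `1, 2, 4, 5, 8, 10, 11`, read at the embeddings with exponents `1, 2, 4, 5, 8, 10, 11`, are linearly independent (the `7 × 7` matrix `([u·c ∈ S])`
is invertible). [cite: Dodson1984, §3.1.0 (p. 11)] [cite: Kubota1965, §2 (p. 115)] -/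
theorem seven_le_cmTypeRank_of_residueSet_eq_P2_twentyOne (Φ : CMType K) (hΦ : residueSet 21 Φ = {1, 2, 4, 10, 13, 16}) :
    7 ≤ cmTypeRank Φ := by
  classical
  have hu : ∀ i : Fin 7, ((![1, 2, 4, 5, 8, 10, 11] : Fin 7 → ZMod 21) i).val.Coprime 21 := by decide
  have hc : ∀ j : Fin 7, ((![1, 2, 4, 5, 8, 10, 11] : Fin 7 → ZMod 21) j).val.Coprime 21 := by decide
  choose τ hτ using fun i : Fin 7 => exists_autExp_eq 21 _ (hu i)
  choose σ hσ using fun j : Fin 7 => exists_expOf_eq 21 K _ (hc j)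
  let f : Fin 7 → (K →+* ℂ) → ℚ := fun i => translateInd Φ.1 (τ i)
  have hval : ∀ i j : Fin 7, f i (σ j) =
      if (![1, 2, 4, 5, 8, 10, 11] : Fin 7 → ZMod 21) i * (![1, 2, 4, 5, 8, 10, 11] : Fin 7 → ZMod 21) j ∈
        ({1, 2, 4, 10, 13, 16} : Finset (ZMod 21)) then (1 : ℚ) else 0 := by
    intro i j
    show translateInd Φ.1 (τ i) (σ j) = _
    rw [translateInd_eq_ite₆₀, hτ, hσ, hΦ]
  have hli : LinearIndependent ℚ f := by
    rw [Fintype.linearIndependent_iff]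
    intro g hg
    have heval : ∀ j : Fin 7, ∑ i, g i * f i (σ j) = 0 := fun j => by
      have := congrFun hg (σ j)
      simpa only [Finset.sum_apply, Pi.smul_apply, smul_eq_mul, Pi.zero_apply] using this
    have e0 := heval 0
    have e1 := heval 1
    have e2 := heval 2
    have e3 := heval 3
    have e4 := heval 4
    have e5 := heval 5
    have e6 := heval 6
    simp (config := { decide := true }) [Fin.sum_univ_seven, hval] at e0 e1 e2 e3 e4 e5 e6
    intro i
    fin_cases i <;> simp <;> linarith
  have h1 : Module.finrank ℚ (Submodule.span ℚ (Set.range f)) = 7 := by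
    rw [finrank_span_eq_card hli, Fintype.card_fin]
  have h2 : Submodule.span ℚ (Set.range f) ≤
      Submodule.span ℚ (Set.range fun g : ℂ ≃+* ℂ => translateInd Φ.1 g) :=
    Submodule.span_mono (by rintro _ ⟨i, rfl⟩; exact ⟨τ i, rfl⟩)
  have h3 := Submodule.finrank_mono h2
  rw [h1] at h3
  exact h3

/-- **`Rank(Φ) ≥ 6` for the type with residue set `{1, 2, 4, 5, 8, 10}`** (`= D1`): the translates by the automorphisms of `ℂ` with cyclotomic
characters `1, 2, 4, 5, 8, 11`, read at the embeddings with exponents `1, 2, 4, 5, 8, 11`, are linearly independent (the `6 × 6` matrix `([u·c ∈ S])`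
is invertible). [cite: Dodson1984, §3.1.0 (p. 11)] [cite: Kubota1965, §2 (p. 115)] -/
theorem six_le_cmTypeRank_of_residueSet_eq_D1_twentyOne (Φ : CMType K) (hΦ : residueSet 21 Φ = {1, 2, 4, 5, 8, 10}) :
    6 ≤ cmTypeRank Φ := by
  classical
  have hu : ∀ i : Fin 6, ((![1, 2, 4, 5, 8, 11] : Fin 6 → ZMod 21) i).val.Coprime 21 := by decide
  have hc : ∀ j : Fin 6, ((![1, 2, 4, 5, 8, 11] : Fin 6 → ZMod 21) j).val.Coprime 21 := by decide
  choose τ hτ using fun i : Fin 6 => exists_autExp_eq 21 _ (hu i)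
  choose σ hσ using fun j : Fin 6 => exists_expOf_eq 21 K _ (hc j)
  let f : Fin 6 → (K →+* ℂ) → ℚ := fun i => translateInd Φ.1 (τ i)
  have hval : ∀ i j : Fin 6, f i (σ j) =
      if (![1, 2, 4, 5, 8, 11] : Fin 6 → ZMod 21) i * (![1, 2, 4, 5, 8, 11] : Fin 6 → ZMod 21) j ∈
        ({1, 2, 4, 5, 8, 10} : Finset (ZMod 21)) then (1 : ℚ) else 0 := by
    intro i j
    show translateInd Φ.1 (τ i) (σ j) = _
    rw [translateInd_eq_ite₆₀, hτ, hσ, hΦ]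
  have hli : LinearIndependent ℚ f := by
    rw [Fintype.linearIndependent_iff]
    intro g hg
    have heval : ∀ j : Fin 6, ∑ i, g i * f i (σ j) = 0 := fun j => by
      have := congrFun hg (σ j)
      simpa only [Finset.sum_apply, Pi.smul_apply, smul_eq_mul, Pi.zero_apply] using this
    have e0 := heval 0
    have e1 := heval 1
    have e2 := heval 2
    have e3 := heval 3
    have e4 := heval 4
    have e5 := heval 5
    simp (config := { decide := true }) [Fin.sum_univ_six, hval] at e0 e1 e2 e3 e4 e5
    intro i
    fin_cases i <;> simp <;> linarith
  have h1 : Module.finrank ℚ (Submodule.span ℚ (Set.range f)) = 6 := by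
    rw [finrank_span_eq_card hli, Fintype.card_fin]
  have h2 : Submodule.span ℚ (Set.range f) ≤
      Submodule.span ℚ (Set.range fun g : ℂ ≃+* ℂ => translateInd Φ.1 g) :=
    Submodule.span_mono (by rintro _ ⟨i, rfl⟩; exact ⟨τ i, rfl⟩)
  have h3 := Submodule.finrank_mono h2
  rw [h1] at h3
  exact h3

/-- **`Rank(Φ) ≥ 6` for the type with residue set `{1, 2, 5, 8, 10, 17}`** (`= D2`): the translates by the automorphisms of `ℂ` with cyclotomic
characters `1, 2, 4, 5, 8, 10`, read at the embeddings with exponents `1, 2, 4, 5, 8, 10`, are linearly independent (the `6 × 6` matrix `([u·c ∈ S])`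
is invertible). [cite: Dodson1984, §3.1.0 (p. 11)] [cite: Kubota1965, §2 (p. 115)] -/
theorem six_le_cmTypeRank_of_residueSet_eq_D2_twentyOne (Φ : CMType K) (hΦ : residueSet 21 Φ = {1, 2, 5, 8, 10, 17}) :
    6 ≤ cmTypeRank Φ := by
  classical
  have hu : ∀ i : Fin 6, ((![1, 2, 4, 5, 8, 10] : Fin 6 → ZMod 21) i).val.Coprime 21 := by decide
  have hc : ∀ j : Fin 6, ((![1, 2, 4, 5, 8, 10] : Fin 6 → ZMod 21) j).val.Coprime 21 := by decide
  choose τ hτ using fun i : Fin 6 => exists_autExp_eq 21 _ (hu i)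
  choose σ hσ using fun j : Fin 6 => exists_expOf_eq 21 K _ (hc j)
  let f : Fin 6 → (K →+* ℂ) → ℚ := fun i => translateInd Φ.1 (τ i)
  have hval : ∀ i j : Fin 6, f i (σ j) =
      if (![1, 2, 4, 5, 8, 10] : Fin 6 → ZMod 21) i * (![1, 2, 4, 5, 8, 10] : Fin 6 → ZMod 21) j ∈
        ({1, 2, 5, 8, 10, 17} : Finset (ZMod 21)) then (1 : ℚ) else 0 := by
    intro i j
    show translateInd Φ.1 (τ i) (σ j) = _
    rw [translateInd_eq_ite₆₀, hτ, hσ, hΦ]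
  have hli : LinearIndependent ℚ f := by
    rw [Fintype.linearIndependent_iff]
    intro g hg
    have heval : ∀ j : Fin 6, ∑ i, g i * f i (σ j) = 0 := fun j => by
      have := congrFun hg (σ j)
      simpa only [Finset.sum_apply, Pi.smul_apply, smul_eq_mul, Pi.zero_apply] using this
    have e0 := heval 0
    have e1 := heval 1
    have e2 := heval 2
    have e3 := heval 3
    have e4 := heval 4
    have e5 := heval 5
    simp (config := { decide := true }) [Fin.sum_univ_six, hval] at e0 e1 e2 e3 e4 e5
    intro i
    fin_cases i <;> simp <;> linarith
  have h1 : Module.finrank ℚ (Submodule.span ℚ (Set.range f)) = 6 := by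
    rw [finrank_span_eq_card hli, Fintype.card_fin]
  have h2 : Submodule.span ℚ (Set.range f) ≤
      Submodule.span ℚ (Set.range fun g : ℂ ≃+* ℂ => translateInd Φ.1 g) :=
    Submodule.span_mono (by rintro _ ⟨i, rfl⟩; exact ⟨τ i, rfl⟩)
  have h3 := Submodule.finrank_mono h2
  rw [h1] at h3
  exact h3

/-- **`Rank = 7 = n + 1` for the types with residue set `P₁` or `P₂`** (Kubota's bound `Rank ≤ n + 1`).
[cite: Kubota1965, §2 (p. 115)] [cite: Dodson1984, §3.1.0 (p. 11)] -/
theorem cmTypeRank_eq_seven_of_residueSet_eq_P_twentyOne (Φ : CMType K)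
    (hΦ : residueSet 21 Φ = {1, 2, 4, 5, 8, 11} ∨ residueSet 21 Φ = {1, 2, 4, 10, 13, 16}) : cmTypeRank Φ = 7 := by
  haveI := isCMField₆₀ K
  refine le_antisymm ?_ ?_
  · have h := cmTypeRank_le Φ
    rw [finrank_eq_twelve₆₀ K] at h
    exact h
  · rcases hΦ with h | h
    · exact seven_le_cmTypeRank_of_residueSet_eq_P1_twentyOne Φ h
    · exact seven_le_cmTypeRank_of_residueSet_eq_P2_twentyOne Φ h

/-- **`Rank ≤ 6 = n` for every type coset-balanced for `W₁` or `W₂`** (Yanai's bound on residues, `cmTypeRank_le_of_cosetBalanced`).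
[cite: Gordon1999HodgeAVSurvey, 9.4.3 (Theorem [B.140])] [cite: Dodson1984, Thm. 3.2.1] -/
theorem cmTypeRank_le_six_of_cosetBalanced_twentyOne (Φ : CMType K)
    (hbal : (∀ c ∈ unitResidues 21, ((({1, 4, 10, 13, 16, 19} : Finset (ZMod 21))).filter fun w => c * w ∈ residueSet 21 Φ).card =
        ((({1, 4, 10, 13, 16, 19} : Finset (ZMod 21))).filter fun w => c * w ∉ residueSet 21 Φ).card) ∨
      (∀ c ∈ unitResidues 21, ((({1, 2, 4, 8, 11, 16} : Finset (ZMod 21))).filter fun w => c * w ∈ residueSet 21 Φ).card =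
        ((({1, 2, 4, 8, 11, 16} : Finset (ZMod 21))).filter fun w => c * w ∉ residueSet 21 Φ).card)) :
    cmTypeRank Φ ≤ 6 := by
  obtain ⟨⟨hu₁, h1₁, hm₁, hn₁, -⟩, ⟨hu₂, h1₂, hm₂, hn₂, -⟩⟩ := subgroups_order_six_twentyOne
  rw [show (6 : ℕ) = Nat.totient 21 / 2 by decide]
  rcases hbal with h | h
  · exact cmTypeRank_le_of_cosetBalanced Φ hu₁ h1₁ hm₁ hn₁ h
  · exact cmTypeRank_le_of_cosetBalanced Φ hu₂ h1₂ hm₂ hn₂ h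

/-- **`Rank = 6` EXACTLY for the types with residue set `D₁` or `D₂`** — Dodson's degenerate primitive types of `ℚ(ζ₂₁)` have rank
`n − l + 2 = 6` (`n = 6 = 3·2`), index of degeneracy `1` (Yanai's bound attained). [cite: Dodson1984, Thm. 3.2.1 (p. 13)]
[cite: Gordon1999HodgeAVSurvey, 9.4.3 (Theorem [B.140])] -/
theorem cmTypeRank_eq_six_of_residueSet_eq_D_twentyOne (Φ : CMType K)
    (hΦ : residueSet 21 Φ = {1, 2, 4, 5, 8, 10} ∨ residueSet 21 Φ = {1, 2, 5, 8, 10, 17}) : cmTypeRank Φ = 6 := by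
  obtain ⟨hb₁, hb₂⟩ := cosetBalanced_D_twentyOne
  refine le_antisymm (cmTypeRank_le_six_of_cosetBalanced_twentyOne Φ ?_) ?_
  · rcases hΦ with h | h
    · left; rw [h]; exact hb₁
    · right; rw [h]; exact hb₂
  · rcases hΦ with h | h
    · exact six_le_cmTypeRank_of_residueSet_eq_D1_twentyOne Φ h
    · exact six_le_cmTypeRank_of_residueSet_eq_D2_twentyOne Φ h

/-- Transport of «not coset-balanced» from the representatives `P₁, P₂` along a family. [cite: Shimura1998, §8.4 Example (1)] -/
private theorem not_cosetBalanced_of_isAutTransform_P_twentyOne {Φ Ψ : CMType K} (h : IsAutTransform Ψ Φ)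
    (hΨ : residueSet 21 Ψ = {1, 2, 4, 5, 8, 11} ∨ residueSet 21 Ψ = {1, 2, 4, 10, 13, 16}) :
    ¬(∀ c ∈ unitResidues 21, ((({1, 4, 10, 13, 16, 19} : Finset (ZMod 21))).filter fun w => c * w ∈ residueSet 21 Φ).card =
        ((({1, 4, 10, 13, 16, 19} : Finset (ZMod 21))).filter fun w => c * w ∉ residueSet 21 Φ).card) ∧
    ¬(∀ c ∈ unitResidues 21, ((({1, 2, 4, 8, 11, 16} : Finset (ZMod 21))).filter fun w => c * w ∈ residueSet 21 Φ).card =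
        ((({1, 2, 4, 8, 11, 16} : Finset (ZMod 21))).filter fun w => c * w ∉ residueSet 21 Φ).card) := by
  obtain ⟨⟨hu₁, -⟩, ⟨hu₂, -⟩⟩ := subgroups_order_six_twentyOne
  obtain ⟨hn₁₁, hn₁₂, hn₂₁, hn₂₂⟩ := not_cosetBalanced_P_twentyOne
  constructor
  · intro hb
    have hb' := cosetBalanced_of_isAutTransform h.symm hu₁ hb
    rcases hΨ with e | e
    · rw [e] at hb'; exact hn₁₁ hb'
    · rw [e] at hb'; exact hn₂₁ hb'
  · intro hb
    have hb' := cosetBalanced_of_isAutTransform h.symm hu₂ hb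
    rcases hΨ with e | e
    · rw [e] at hb'; exact hn₁₂ hb'
    · rw [e] at hb'; exact hn₂₂ hb'

/-- **THE RANK DICHOTOMY FOR THE PRIMITIVE TYPES OF `ℚ(ζ₂₁)`**: a primitive type is either NOT coset-balanced for `W₁`, `W₂` and of rank
`7 = n + 1`, or coset-balanced for one of them and of rank `6`. [cite: Dodson1984, §3.1.0 and Thm. 3.2.1] [cite: Shimura1998, §8.4 Example (1)] -/
theorem cmTypeRank_eq_seven_or_six_of_isPrimitive_twentyOne (Φ : CMType K) (φ₀ : K →+* ℂ) (hΦ : IsPrimitive (ℂ ≃+* ℂ) Φ.1 φ₀) :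
    (¬(∀ c ∈ unitResidues 21, ((({1, 4, 10, 13, 16, 19} : Finset (ZMod 21))).filter fun w => c * w ∈ residueSet 21 Φ).card =
        ((({1, 4, 10, 13, 16, 19} : Finset (ZMod 21))).filter fun w => c * w ∉ residueSet 21 Φ).card) ∧
      ¬(∀ c ∈ unitResidues 21, ((({1, 2, 4, 8, 11, 16} : Finset (ZMod 21))).filter fun w => c * w ∈ residueSet 21 Φ).card =
        ((({1, 2, 4, 8, 11, 16} : Finset (ZMod 21))).filter fun w => c * w ∉ residueSet 21 Φ).card) ∧ cmTypeRank Φ = 7) ∨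
    (((∀ c ∈ unitResidues 21, ((({1, 4, 10, 13, 16, 19} : Finset (ZMod 21))).filter fun w => c * w ∈ residueSet 21 Φ).card =
        ((({1, 4, 10, 13, 16, 19} : Finset (ZMod 21))).filter fun w => c * w ∉ residueSet 21 Φ).card) ∨
      (∀ c ∈ unitResidues 21, ((({1, 2, 4, 8, 11, 16} : Finset (ZMod 21))).filter fun w => c * w ∈ residueSet 21 Φ).card =
        ((({1, 2, 4, 8, 11, 16} : Finset (ZMod 21))).filter fun w => c * w ∉ residueSet 21 Φ).card)) ∧ cmTypeRank Φ = 6) := by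
  obtain ⟨⟨hu₁, -⟩, ⟨hu₂, -⟩⟩ := subgroups_order_six_twentyOne
  obtain ⟨hb₁, hb₂⟩ := cosetBalanced_D_twentyOne
  obtain ⟨Ψ, hΨ, hT⟩ := exists_isAutTransform_of_isPrimitive_twentyOne Φ φ₀ hΦ
  rcases hΨ with h | h | h | h
  · obtain ⟨n₁, n₂⟩ := not_cosetBalanced_of_isAutTransform_P_twentyOne hT (Or.inl h)
    exact Or.inl ⟨n₁, n₂, by rw [cmTypeRank_eq_of_isAutTransform hT, cmTypeRank_eq_seven_of_residueSet_eq_P_twentyOne Ψ (Or.inl h)]⟩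
  · obtain ⟨n₁, n₂⟩ := not_cosetBalanced_of_isAutTransform_P_twentyOne hT (Or.inr h)
    exact Or.inl ⟨n₁, n₂, by rw [cmTypeRank_eq_of_isAutTransform hT, cmTypeRank_eq_seven_of_residueSet_eq_P_twentyOne Ψ (Or.inr h)]⟩
  · refine Or.inr ⟨Or.inl (cosetBalanced_of_isAutTransform hT hu₁ (by rw [h]; exact hb₁)), ?_⟩
    rw [cmTypeRank_eq_of_isAutTransform hT, cmTypeRank_eq_six_of_residueSet_eq_D_twentyOne Ψ (Or.inl h)]
  · refine Or.inr ⟨Or.inr (cosetBalanced_of_isAutTransform hT hu₂ (by rw [h]; exact hb₂)), ?_⟩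
    rw [cmTypeRank_eq_of_isAutTransform hT, cmTypeRank_eq_six_of_residueSet_eq_D_twentyOne Ψ (Or.inr h)]

/-- **A primitive type of `ℚ(ζ₂₁)` NOT coset-balanced for `W₁`, `W₂` has rank `7`.** [cite: Dodson1984, §3.1.0 (p. 11)] -/
theorem cmTypeRank_eq_seven_of_not_cosetBalanced_twentyOne (Φ : CMType K) (φ₀ : K →+* ℂ) (hΦ : IsPrimitive (ℂ ≃+* ℂ) Φ.1 φ₀)
    (h₁ : ¬(∀ c ∈ unitResidues 21, ((({1, 4, 10, 13, 16, 19} : Finset (ZMod 21))).filter fun w => c * w ∈ residueSet 21 Φ).card =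
        ((({1, 4, 10, 13, 16, 19} : Finset (ZMod 21))).filter fun w => c * w ∉ residueSet 21 Φ).card))
    (h₂ : ¬(∀ c ∈ unitResidues 21, ((({1, 2, 4, 8, 11, 16} : Finset (ZMod 21))).filter fun w => c * w ∈ residueSet 21 Φ).card =
        ((({1, 2, 4, 8, 11, 16} : Finset (ZMod 21))).filter fun w => c * w ∉ residueSet 21 Φ).card)) :
    cmTypeRank Φ = 7 := by
  rcases cmTypeRank_eq_seven_or_six_of_isPrimitive_twentyOne Φ φ₀ hΦ with ⟨-, -, h⟩ | ⟨hb, -⟩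
  · exact h
  · exact absurd hb (not_or.2 ⟨h₁, h₂⟩)

/-- **A primitive type of `ℚ(ζ₂₁)` coset-balanced for `W₁` or `W₂` has rank EXACTLY `6`.** [cite: Dodson1984, Thm. 3.2.1 (p. 13)] -/
theorem cmTypeRank_eq_six_of_cosetBalanced_twentyOne (Φ : CMType K) (φ₀ : K →+* ℂ) (hΦ : IsPrimitive (ℂ ≃+* ℂ) Φ.1 φ₀)
    (hbal : (∀ c ∈ unitResidues 21, ((({1, 4, 10, 13, 16, 19} : Finset (ZMod 21))).filter fun w => c * w ∈ residueSet 21 Φ).card =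
        ((({1, 4, 10, 13, 16, 19} : Finset (ZMod 21))).filter fun w => c * w ∉ residueSet 21 Φ).card) ∨
      (∀ c ∈ unitResidues 21, ((({1, 2, 4, 8, 11, 16} : Finset (ZMod 21))).filter fun w => c * w ∈ residueSet 21 Φ).card =
        ((({1, 2, 4, 8, 11, 16} : Finset (ZMod 21))).filter fun w => c * w ∉ residueSet 21 Φ).card)) :
    cmTypeRank Φ = 6 := by
  rcases cmTypeRank_eq_seven_or_six_of_isPrimitive_twentyOne Φ φ₀ hΦ with ⟨h₁, h₂, -⟩ | ⟨-, h⟩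
  · exact absurd hbal (not_or.2 ⟨h₁, h₂⟩)
  · exact h

omit [IsCyclotomicExtension {21} ℚ K] in
/-- **NONDEGENERATE ⟺ PRIMITIVE AND NOT COSET-BALANCED, for the CM types of `ℚ(ζ₂₁)`** (imprimitive types are degenerate — Kubota —, and
among the primitive ones exactly Dodson's two families are). [cite: Dodson1984, §3.1.0 and Thm. 3.2.1] [cite: Kubota1965, §2 (p. 115)] -/
theorem isNondegenerate_iff_twentyOne (hK : IsCyclotomicExtension {21} ℚ K) (Φ : CMType K) (φ₀ : K →+* ℂ) :
    IsNondegenerate Φ ↔ IsPrimitive (ℂ ≃+* ℂ) Φ.1 φ₀ ∧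
      ¬(∀ c ∈ unitResidues 21, ((({1, 4, 10, 13, 16, 19} : Finset (ZMod 21))).filter fun w => c * w ∈ residueSet 21 Φ).card =
        ((({1, 4, 10, 13, 16, 19} : Finset (ZMod 21))).filter fun w => c * w ∉ residueSet 21 Φ).card) ∧
      ¬(∀ c ∈ unitResidues 21, ((({1, 2, 4, 8, 11, 16} : Finset (ZMod 21))).filter fun w => c * w ∈ residueSet 21 Φ).card =
        ((({1, 2, 4, 8, 11, 16} : Finset (ZMod 21))).filter fun w => c * w ∉ residueSet 21 Φ).card) := by
  haveI := isCMField₆₀ K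
  rw [isNondegenerate_iff, finrank_eq_twelve₆₀ K]
  constructor
  · intro h
    have hnd : IsNondegenerate Φ := by rw [isNondegenerate_iff, finrank_eq_twelve₆₀ K]; exact h
    have hp := hnd.isPrimitive φ₀
    rcases cmTypeRank_eq_seven_or_six_of_isPrimitive_twentyOne Φ φ₀ hp with ⟨h₁, h₂, -⟩ | ⟨-, h6⟩
    · exact ⟨hp, h₁, h₂⟩
    · omega
  · rintro ⟨hp, h₁, h₂⟩
    exact cmTypeRank_eq_seven_of_not_cosetBalanced_twentyOne Φ φ₀ hp h₁ h₂

set_option maxRecDepth 100000 in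
/-- The counts on residues: `24` CM residue sets of `ℤ/21` have trivial stabiliser and are coset-balanced for `W₁` or `W₂` (two orbits of
`12`), `24` have trivial stabiliser and are not. [cite: Dodson1984, Thm. 3.2.1] [cite: Shimura1998, §8.4 Example (1)] -/
private theorem card_filter_cosetBalanced_twentyOne :
    (({1, 2, 4, 5, 8, 10} : Finset (ZMod 21)).powerset.filter (fun T =>
      HasTrivialStabilizer 21 (T ∪ (({1, 2, 4, 5, 8, 10} : Finset (ZMod 21)) \ T).image Neg.neg) ∧
      ((∀ c ∈ unitResidues 21, ((({1, 4, 10, 13, 16, 19} : Finset (ZMod 21))).filter fun w => c * w ∈ T ∪ (({1, 2, 4, 5, 8, 10} : Finset (ZMod 21)) \ T).image Neg.neg).card =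
          ((({1, 4, 10, 13, 16, 19} : Finset (ZMod 21))).filter fun w => c * w ∉ T ∪ (({1, 2, 4, 5, 8, 10} : Finset (ZMod 21)) \ T).image Neg.neg).card) ∨
       (∀ c ∈ unitResidues 21, ((({1, 2, 4, 8, 11, 16} : Finset (ZMod 21))).filter fun w => c * w ∈ T ∪ (({1, 2, 4, 5, 8, 10} : Finset (ZMod 21)) \ T).image Neg.neg).card =
          ((({1, 2, 4, 8, 11, 16} : Finset (ZMod 21))).filter fun w => c * w ∉ T ∪ (({1, 2, 4, 5, 8, 10} : Finset (ZMod 21)) \ T).image Neg.neg).card)))).card = 24 ∧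
    (({1, 2, 4, 5, 8, 10} : Finset (ZMod 21)).powerset.filter (fun T =>
      HasTrivialStabilizer 21 (T ∪ (({1, 2, 4, 5, 8, 10} : Finset (ZMod 21)) \ T).image Neg.neg) ∧
      ¬(∀ c ∈ unitResidues 21, ((({1, 4, 10, 13, 16, 19} : Finset (ZMod 21))).filter fun w => c * w ∈ T ∪ (({1, 2, 4, 5, 8, 10} : Finset (ZMod 21)) \ T).image Neg.neg).card =
          ((({1, 4, 10, 13, 16, 19} : Finset (ZMod 21))).filter fun w => c * w ∉ T ∪ (({1, 2, 4, 5, 8, 10} : Finset (ZMod 21)) \ T).image Neg.neg).card) ∧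
      ¬(∀ c ∈ unitResidues 21, ((({1, 2, 4, 8, 11, 16} : Finset (ZMod 21))).filter fun w => c * w ∈ T ∪ (({1, 2, 4, 5, 8, 10} : Finset (ZMod 21)) \ T).image Neg.neg).card =
          ((({1, 2, 4, 8, 11, 16} : Finset (ZMod 21))).filter fun w => c * w ∉ T ∪ (({1, 2, 4, 5, 8, 10} : Finset (ZMod 21)) \ T).image Neg.neg).card))).card = 24 := by
  constructor <;> decide +kernel

omit [IsCyclotomicExtension {21} ℚ K] in
/-- **`24` of the `64` CM types of `ℚ(ζ₂₁)` are primitive and coset-balanced (Dodson's two degenerate families of `12`), and `24` are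
NONDEGENERATE (the other two primitive families).** [cite: Dodson1984, Thm. 3.2.1] [cite: Shimura1998, §8.4 Example (1)] -/
theorem ncard_isNondegenerate_twentyOne (hK : IsCyclotomicExtension {21} ℚ K) (φ₀ : K →+* ℂ) :
    {Φ : CMType K | IsPrimitive (ℂ ≃+* ℂ) Φ.1 φ₀ ∧
      ((∀ c ∈ unitResidues 21, ((({1, 4, 10, 13, 16, 19} : Finset (ZMod 21))).filter fun w => c * w ∈ residueSet 21 Φ).card =
        ((({1, 4, 10, 13, 16, 19} : Finset (ZMod 21))).filter fun w => c * w ∉ residueSet 21 Φ).card) ∨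
       (∀ c ∈ unitResidues 21, ((({1, 2, 4, 8, 11, 16} : Finset (ZMod 21))).filter fun w => c * w ∈ residueSet 21 Φ).card =
        ((({1, 2, 4, 8, 11, 16} : Finset (ZMod 21))).filter fun w => c * w ∉ residueSet 21 Φ).card))}.ncard = 24 ∧
    {Φ : CMType K | IsNondegenerate Φ}.ncard = 24 := by
  constructor
  · rw [ncard_setOf_eq_card_filter_powerset_half 21 (isCMResidueSet_reps_twentyOne).2.2.1 _
      (fun S => HasTrivialStabilizer 21 S ∧
        ((∀ c ∈ unitResidues 21, ((({1, 4, 10, 13, 16, 19} : Finset (ZMod 21))).filter fun w => c * w ∈ S).card = ((({1, 4, 10, 13, 16, 19} : Finset (ZMod 21))).filter fun w => c * w ∉ S).card) ∨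
         (∀ c ∈ unitResidues 21, ((({1, 2, 4, 8, 11, 16} : Finset (ZMod 21))).filter fun w => c * w ∈ S).card = ((({1, 2, 4, 8, 11, 16} : Finset (ZMod 21))).filter fun w => c * w ∉ S).card)))
      (fun Φ => by rw [isPrimitive_iff_hasTrivialStabilizer 21 Φ φ₀])]
    exact card_filter_cosetBalanced_twentyOne.1
  · rw [ncard_setOf_eq_card_filter_powerset_half 21 (isCMResidueSet_reps_twentyOne).2.2.1 _
      (fun S => HasTrivialStabilizer 21 S ∧
        ¬(∀ c ∈ unitResidues 21, ((({1, 4, 10, 13, 16, 19} : Finset (ZMod 21))).filter fun w => c * w ∈ S).card = ((({1, 4, 10, 13, 16, 19} : Finset (ZMod 21))).filter fun w => c * w ∉ S).card) ∧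
        ¬(∀ c ∈ unitResidues 21, ((({1, 2, 4, 8, 11, 16} : Finset (ZMod 21))).filter fun w => c * w ∈ S).card = ((({1, 2, 4, 8, 11, 16} : Finset (ZMod 21))).filter fun w => c * w ∉ S).card))
      (fun Φ => by rw [isNondegenerate_iff_twentyOne hK Φ φ₀, isPrimitive_iff_hasTrivialStabilizer 21 Φ φ₀])]
    exact card_filter_cosetBalanced_twentyOne.2

end Types

/-! ### §2 Abelian varieties with complex multiplication by `ℚ(ζ₂₁)` -/

section Varieties

variable {K : Type} [Field K] [NumberField K]
  {A : AbelianVariety ℂ} {ι : 𝓞 K →+* End A} {θ : K →+* Module.End ℂ (complexBetti A.X 1)}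

/-- `Bᵐ ⊗ ℂ = Dᵐ ⊗ ℂ` for all `m` on an abelian variety gives the Hodge conjecture for it. [cite: Gordon1999HodgeAVSurvey, §9.3] -/
private theorem hodgeConjectureFor_of_forall_hodgeClassSpan_eq₆₀ (B : AbelianVariety ℂ)
    (h : ∀ m : ℕ, hodgeClassSpan B.dim B.X m = divisorClassesSpan B.X B.dim m) : HodgeConjectureFor B.dim B.X :=
  ⟨Literature.AlgebraicGeometry.HodgeTheory.nonempty_hodgeModel_holds
      (Literature.AlgebraicGeometry.Motives.AbelianVariety.isSmoothProjective_holds (A := B)),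
    fun m _ hc hmm ↦ Literature.AlgebraicGeometry.HodgeTheory.AbelianVariety.divisorClassesSpan_le_algebraicClasses B
      (fun b hb hb' ↦ Literature.AlgebraicGeometry.HodgeTheory.lefschetzOneOne_rational_holds
        (Literature.AlgebraicGeometry.Motives.AbelianVariety.isSmoothProjective_holds (A := B)) b hb hb') m
      ((h m) ▸ Submodule.subset_span ⟨hc, hmm⟩)⟩

/-- `dim A = 6` for a realisation of a CM type of `ℚ(ζ₂₁)`. [cite: Shimura1998, §6.2 Theorem 3] -/
theorem dim_eq_six_of_isCMTypeRealisation_twentyOne (hK : IsCyclotomicExtension {21} ℚ K) {Φ : CMType K} (hA : IsCMTypeRealisation Φ A ι θ) :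
    A.dim = 6 := by
  have h := Literature.AlgebraicGeometry.Motives.schemeDim_eq_holds hA.1
  rw [finrank_eq_twelve₆₀ K] at h
  exact h

/-- **The tree's type `Φ₂₁` of `DegenerateCMTypeCyclotomic21` has residue set `D₁ = {1, 2, 4, 5, 8, 10}`**: its family is the `W₁`-family of this file
(its `not_isNondegenerate_Φ₂₁`, `cmTypeRank_Φ₂₁ = 6`, `exists_exceptional_Φ₂₁` are the case `Φ = Φ₂₁` of §1–§2).
[cite: Dodson1984, Thm. 3.2.1] [cite: Gordon1999HodgeAVSurvey, 9.4.3] -/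
theorem residueSet_Φ₂₁ [IsCyclotomicExtension {21} ℚ K] :
    residueSet 21 (Literature.AlgebraicGeometry.Pohlmann1968.Cyclotomic.Φ₂₁ K) = {1, 2, 4, 5, 8, 10} := by
  ext c
  rw [Literature.AlgebraicGeometry.ComplexMultiplication.CyclotomicCMTypeResidueSets.mem_residueSet_iff]
  constructor
  · rintro ⟨σ, hσ, rfl⟩
    exact hσ
  · intro hc
    have hcu : c.val.Coprime 21 := by
      have : c ∈ unitResidues 21 := by
        have hsub : ({1, 2, 4, 5, 8, 10} : Finset (ZMod 21)) ⊆ unitResidues 21 := by decide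
        exact hsub hc
      exact (coprime_iff_mem_unitResidues 21 c).2 this
    obtain ⟨σ, hσ⟩ := exists_expOf_eq 21 K c hcu
    exact ⟨σ, by rw [← hσ] at hc; exact hc, hσ⟩

/-- **`Bᵐ(Aⁿ) ⊗ ℂ = Dᵐ(Aⁿ) ⊗ ℂ` FOR ALL `n, m`, FOR EVERY TYPE OF `ℚ(ζ₂₁)` THAT IS NOT A PRIMITIVE COSET-BALANCED ONE** (imprimitive: induced,
degree-`≤ 12` theorem; primitive non-coset-balanced: rank `7`, nondegenerate) — `40` of the `64` types.
[cite: Gordon1999HodgeAVSurvey, Thm. 6.4 and §9.3] [cite: Dodson1984, §3.1.0] -/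
theorem hodgeClassSpan_pow_eq_divisorClassesSpan_of_not_cosetBalanced_twentyOne (hK : IsCyclotomicExtension {21} ℚ K) (Φ : CMType K) (φ₀ : K →+* ℂ)
    (h : IsPrimitive (ℂ ≃+* ℂ) Φ.1 φ₀ →
      ¬(∀ c ∈ unitResidues 21, ((({1, 4, 10, 13, 16, 19} : Finset (ZMod 21))).filter fun w => c * w ∈ residueSet 21 Φ).card =
        ((({1, 4, 10, 13, 16, 19} : Finset (ZMod 21))).filter fun w => c * w ∉ residueSet 21 Φ).card) ∧
      ¬(∀ c ∈ unitResidues 21, ((({1, 2, 4, 8, 11, 16} : Finset (ZMod 21))).filter fun w => c * w ∈ residueSet 21 Φ).card =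
        ((({1, 2, 4, 8, 11, 16} : Finset (ZMod 21))).filter fun w => c * w ∉ residueSet 21 Φ).card))
    (hA : IsCMTypeRealisation Φ A ι θ) (n m : ℕ) :
    hodgeClassSpan (⨁ fun _ : Fin n => A).dim (⨁ fun _ : Fin n => A).X m =
      divisorClassesSpan (⨁ fun _ : Fin n => A).X (⨁ fun _ : Fin n => A).dim m := by
  haveI := isCMField₆₀ K
  by_cases hΦ : IsPrimitive (ℂ ≃+* ℂ) Φ.1 φ₀
  · obtain ⟨h₁, h₂⟩ := h hΦ
    exact ((isNondegenerate_iff_twentyOne hK Φ φ₀).2 ⟨hΦ, h₁, h₂⟩).hodgeClassSpan_pow_eq_divisorClassesSpan hA n m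
  · exact hodgeClassSpan_pow_eq_divisorClassesSpan_of_not_isPrimitive_of_finrank_le_twelve (by rw [finrank_eq_twelve₆₀ K]) Φ φ₀ hΦ hA n m

/-- **THE HODGE CONJECTURE FOR EVERY POWER OF EVERY ABELIAN VARIETY WITH COMPLEX MULTIPLICATION BY `ℚ(ζ₂₁)` WHOSE TYPE IS NOT A PRIMITIVE
COSET-BALANCED ONE** (`40` of the `64` types), unconditionally. [cite: Gordon1999HodgeAVSurvey, Thm. 6.4 and §9.3] [cite: Dodson1984, §3.1.0] -/
theorem hodgeConjectureFor_pow_of_not_cosetBalanced_twentyOne (hK : IsCyclotomicExtension {21} ℚ K) (Φ : CMType K) (φ₀ : K →+* ℂ)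
    (h : IsPrimitive (ℂ ≃+* ℂ) Φ.1 φ₀ →
      ¬(∀ c ∈ unitResidues 21, ((({1, 4, 10, 13, 16, 19} : Finset (ZMod 21))).filter fun w => c * w ∈ residueSet 21 Φ).card =
        ((({1, 4, 10, 13, 16, 19} : Finset (ZMod 21))).filter fun w => c * w ∉ residueSet 21 Φ).card) ∧
      ¬(∀ c ∈ unitResidues 21, ((({1, 2, 4, 8, 11, 16} : Finset (ZMod 21))).filter fun w => c * w ∈ residueSet 21 Φ).card =
        ((({1, 2, 4, 8, 11, 16} : Finset (ZMod 21))).filter fun w => c * w ∉ residueSet 21 Φ).card))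
    (hA : IsCMTypeRealisation Φ A ι θ) (n : ℕ) :
    HodgeConjectureFor (⨁ fun _ : Fin n => A).dim (⨁ fun _ : Fin n => A).X :=
  hodgeConjectureFor_of_forall_hodgeClassSpan_eq₆₀ _
    (fun m ↦ hodgeClassSpan_pow_eq_divisorClassesSpan_of_not_cosetBalanced_twentyOne hK Φ φ₀ h hA n m)

/-- **EVERY REALISATION OF A PRIMITIVE COSET-BALANCED TYPE OF `ℚ(ζ₂₁)` IS A SIMPLE ABELIAN SIXFOLD CARRYING RATIONAL `(3,3)`-CLASSES OUTSIDE
`D³(A) ⊗ ℂ`** — the Weil classes of `(A, k)` for the imaginary quadratic subfield `k` = ℚ(√−3) = ℚ(ζ₃) (`W₁`) resp. ℚ(√−7) (`W₂`) acting with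
multiplicities `(3,3)`; `dim B³ − dim D³ ≥ 2`.  These are Dodson's simple degenerate CM abelian varieties of dimension `6` and rank `6`.
[cite: Dodson1984, Thm. 3.2.1 (p. 13)] [cite: Gordon1999HodgeAVSurvey, 5.13 (ii) and 9.2.2] [cite: vanGeemen1994HodgeAV, Thm. 4.5 and 4.7]
[cite: Pohlmann1968, §3] [cite: Shimura1998, §8.2 Prop. 26] -/
theorem exists_exceptional_of_cosetBalanced_twentyOne (hK : IsCyclotomicExtension {21} ℚ K) (Φ : CMType K) (φ₀ : K →+* ℂ)
    (hΦ : IsPrimitive (ℂ ≃+* ℂ) Φ.1 φ₀)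
    (hbal : (∀ c ∈ unitResidues 21, ((({1, 4, 10, 13, 16, 19} : Finset (ZMod 21))).filter fun w => c * w ∈ residueSet 21 Φ).card =
        ((({1, 4, 10, 13, 16, 19} : Finset (ZMod 21))).filter fun w => c * w ∉ residueSet 21 Φ).card) ∨
      (∀ c ∈ unitResidues 21, ((({1, 2, 4, 8, 11, 16} : Finset (ZMod 21))).filter fun w => c * w ∈ residueSet 21 Φ).card =
        ((({1, 2, 4, 8, 11, 16} : Finset (ZMod 21))).filter fun w => c * w ∉ residueSet 21 Φ).card))
    (hA : IsCMTypeRealisation Φ A ι θ) :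
    A.IsSimple ∧ A.dim = 6 ∧
      (∃ c : complexBetti A.X (2 * 3), IsRationalClass c ∧ IsOfHodgeType 6 A.X (2 * 3) 3 3 c ∧ c ∉ divisorClassesSpan A.X 6 3) ∧
      2 ≤ Module.finrank ℂ ↥(hodgeClassSpan 6 A.X 3) - Module.finrank ℂ ↥(divisorClassesSpan A.X 6 3) := by
  obtain ⟨⟨hu₁, h1₁, hm₁, hn₁, hc₁⟩, ⟨hu₂, h1₂, hm₂, hn₂, hc₂⟩⟩ := subgroups_order_six_twentyOne
  have hprim : HasTrivialStabilizer 21 (residueSet 21 Φ) := (isPrimitive_iff_hasTrivialStabilizer 21 Φ φ₀).1 hΦ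
  have htot : Nat.totient 21 / 2 = 6 := by decide
  refine ⟨isSimple_of_isCMTypeRealisation_of_isPrimitive hA φ₀ hΦ, dim_eq_six_of_isCMTypeRealisation_twentyOne hK hA, ?_, ?_⟩
  · rcases hbal with hb | hb
    · obtain ⟨c, hcQ, hcH, hcD⟩ := exists_exceptional_of_cosetBalanced hu₁ h1₁ hm₁ hn₁ hb hprim hc₁ hA
      rw [htot] at hcH hcD
      exact ⟨c, hcQ, hcH, hcD⟩
    · obtain ⟨c, hcQ, hcH, hcD⟩ := exists_exceptional_of_cosetBalanced hu₂ h1₂ hm₂ hn₂ hb hprim hc₂ hA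
      rw [htot] at hcH hcD
      exact ⟨c, hcQ, hcH, hcD⟩
  · rcases hbal with hb | hb
    · have h := two_le_finrank_hodgeClassSpan_sub_finrank_divisorClassesSpan_of_cosetBalanced hu₁ h1₁ hm₁ hn₁ hb hprim hc₁ hA
      rwa [htot] at h
    · have h := two_le_finrank_hodgeClassSpan_sub_finrank_divisorClassesSpan_of_cosetBalanced hu₂ h1₂ hm₂ hn₂ hb hprim hc₂ hA
      rwa [htot] at h

/-- **`B³(A) ⊗ ℂ ≠ D³(A) ⊗ ℂ`** for every realisation of a primitive coset-balanced type of `ℚ(ζ₂₁)`. [cite: Dodson1984, Thm. 3.2.1]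
[cite: Gordon1999HodgeAVSurvey, 5.13 (ii)] -/
theorem hodgeClassSpan_three_ne_twentyOne (hK : IsCyclotomicExtension {21} ℚ K) (Φ : CMType K) (φ₀ : K →+* ℂ)
    (hΦ : IsPrimitive (ℂ ≃+* ℂ) Φ.1 φ₀)
    (hbal : (∀ c ∈ unitResidues 21, ((({1, 4, 10, 13, 16, 19} : Finset (ZMod 21))).filter fun w => c * w ∈ residueSet 21 Φ).card =
        ((({1, 4, 10, 13, 16, 19} : Finset (ZMod 21))).filter fun w => c * w ∉ residueSet 21 Φ).card) ∨
      (∀ c ∈ unitResidues 21, ((({1, 2, 4, 8, 11, 16} : Finset (ZMod 21))).filter fun w => c * w ∈ residueSet 21 Φ).card =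
        ((({1, 2, 4, 8, 11, 16} : Finset (ZMod 21))).filter fun w => c * w ∉ residueSet 21 Φ).card))
    (hA : IsCMTypeRealisation Φ A ι θ) :
    hodgeClassSpan 6 A.X 3 ≠ divisorClassesSpan A.X 6 3 := by
  obtain ⟨-, -, ⟨c, hcQ, hcH, hcD⟩, -⟩ := exists_exceptional_of_cosetBalanced_twentyOne hK Φ φ₀ hΦ hbal hA
  intro h
  exact hcD (h ▸ Submodule.subset_span ⟨hcQ, hcH⟩)

/-- **THE DICHOTOMY FOR THE CM ABELIAN VARIETIES OF `ℚ(ζ₂₁)`**: for every abelian variety `A` with complex multiplication by `ℚ(ζ₂₁)` (any type):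
EITHER `B•(Aⁿ) ⊗ ℂ = D•(Aⁿ) ⊗ ℂ` for all `n` and the Hodge conjecture holds for every power of `A` (`40` types), OR the type is primitive and
coset-balanced (Dodson's `24` types) and `A` is a simple sixfold with `B³(A) ⊗ ℂ ≠ D³(A) ⊗ ℂ`.
[cite: Dodson1984, §3.1.0 and Thm. 3.2.1] [cite: Gordon1999HodgeAVSurvey, Thm. 6.4, §9.3, 5.13 (ii)] -/
theorem hodgeConjectureFor_pow_or_exceptional_twentyOne (hK : IsCyclotomicExtension {21} ℚ K) (Φ : CMType K) (φ₀ : K →+* ℂ)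
    (hA : IsCMTypeRealisation Φ A ι θ) :
    ((∀ n m : ℕ, hodgeClassSpan (⨁ fun _ : Fin n => A).dim (⨁ fun _ : Fin n => A).X m =
        divisorClassesSpan (⨁ fun _ : Fin n => A).X (⨁ fun _ : Fin n => A).dim m) ∧
      ∀ n : ℕ, HodgeConjectureFor (⨁ fun _ : Fin n => A).dim (⨁ fun _ : Fin n => A).X) ∨
    (IsPrimitive (ℂ ≃+* ℂ) Φ.1 φ₀ ∧
      ((∀ c ∈ unitResidues 21, ((({1, 4, 10, 13, 16, 19} : Finset (ZMod 21))).filter fun w => c * w ∈ residueSet 21 Φ).card =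
        ((({1, 4, 10, 13, 16, 19} : Finset (ZMod 21))).filter fun w => c * w ∉ residueSet 21 Φ).card) ∨
       (∀ c ∈ unitResidues 21, ((({1, 2, 4, 8, 11, 16} : Finset (ZMod 21))).filter fun w => c * w ∈ residueSet 21 Φ).card =
        ((({1, 2, 4, 8, 11, 16} : Finset (ZMod 21))).filter fun w => c * w ∉ residueSet 21 Φ).card)) ∧
      A.IsSimple ∧ A.dim = 6 ∧ hodgeClassSpan 6 A.X 3 ≠ divisorClassesSpan A.X 6 3) := by
  by_cases h : IsPrimitive (ℂ ≃+* ℂ) Φ.1 φ₀ ∧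
      ((∀ c ∈ unitResidues 21, ((({1, 4, 10, 13, 16, 19} : Finset (ZMod 21))).filter fun w => c * w ∈ residueSet 21 Φ).card =
        ((({1, 4, 10, 13, 16, 19} : Finset (ZMod 21))).filter fun w => c * w ∉ residueSet 21 Φ).card) ∨
       (∀ c ∈ unitResidues 21, ((({1, 2, 4, 8, 11, 16} : Finset (ZMod 21))).filter fun w => c * w ∈ residueSet 21 Φ).card =
        ((({1, 2, 4, 8, 11, 16} : Finset (ZMod 21))).filter fun w => c * w ∉ residueSet 21 Φ).card))
  · obtain ⟨hS, hd, -⟩ := exists_exceptional_of_cosetBalanced_twentyOne hK Φ φ₀ h.1 h.2 hA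
    exact Or.inr ⟨h.1, h.2, hS, hd, hodgeClassSpan_three_ne_twentyOne hK Φ φ₀ h.1 h.2 hA⟩
  · have h' : IsPrimitive (ℂ ≃+* ℂ) Φ.1 φ₀ →
        ¬(∀ c ∈ unitResidues 21, ((({1, 4, 10, 13, 16, 19} : Finset (ZMod 21))).filter fun w => c * w ∈ residueSet 21 Φ).card =
        ((({1, 4, 10, 13, 16, 19} : Finset (ZMod 21))).filter fun w => c * w ∉ residueSet 21 Φ).card) ∧
        ¬(∀ c ∈ unitResidues 21, ((({1, 2, 4, 8, 11, 16} : Finset (ZMod 21))).filter fun w => c * w ∈ residueSet 21 Φ).card =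
        ((({1, 2, 4, 8, 11, 16} : Finset (ZMod 21))).filter fun w => c * w ∉ residueSet 21 Φ).card) := fun hp ↦ not_or.1 fun hb ↦ h ⟨hp, hb⟩
    exact Or.inl ⟨fun n m ↦ hodgeClassSpan_pow_eq_divisorClassesSpan_of_not_cosetBalanced_twentyOne hK Φ φ₀ h' hA n m,
      fun n ↦ hodgeConjectureFor_pow_of_not_cosetBalanced_twentyOne hK Φ φ₀ h' hA n⟩

variable (K) in
/-- **NON-VACUITY (Shimura §6.2 Thm. 3, tree `exists_isCMTypeRealisation`): there IS a simple abelian SIXFOLD with complex multiplication by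
`𝓞_{ℚ(ζ₂₁)}` of a primitive coset-balanced type — with `B³ ≠ D³`** — and there is one of a nondegenerate type, all of whose powers satisfy the
Hodge conjecture. [cite: Shimura1998, §6.2 Thm. 3] [cite: Dodson1984, Thm. 3.2.1] -/
theorem exists_isSimple_exceptional_twentyOne [hK : IsCyclotomicExtension {21} ℚ K] :
    (∃ (Φ : CMType K) (A : AbelianVariety ℂ) (ι' : 𝓞 K →+* End A) (θ' : K →+* Module.End ℂ (complexBetti A.X 1)),
      IsCMTypeRealisation Φ A ι' θ' ∧ A.IsSimple ∧ A.dim = 6 ∧ hodgeClassSpan 6 A.X 3 ≠ divisorClassesSpan A.X 6 3) ∧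
    (∃ (Φ : CMType K) (A : AbelianVariety ℂ) (ι' : 𝓞 K →+* End A) (θ' : K →+* Module.End ℂ (complexBetti A.X 1)),
      IsCMTypeRealisation Φ A ι' θ' ∧ A.IsSimple ∧ A.dim = 6 ∧
        ∀ n : ℕ, HodgeConjectureFor (⨁ fun _ : Fin n => A).dim (⨁ fun _ : Fin n => A).X) := by
  haveI := isCMField₆₀ K
  obtain ⟨φ₀⟩ : Nonempty (K →+* ℂ) := inferInstance
  obtain ⟨Φ₁, -, Φ₃, -, -, -, -, -, hr₁, -, hr₃, -, -, -, -, -, ⟨hp₁, -, hp₃, -⟩, -⟩ := exists_eight_families_twentyOne (L := K) φ₀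
  obtain ⟨hb₁, -⟩ := cosetBalanced_D_twentyOne
  constructor
  · obtain ⟨A, ι', θ', hA⟩ := Literature.AlgebraicGeometry.ComplexMultiplication.exists_isCMTypeRealisation Φ₃
    have hbal : (∀ c ∈ unitResidues 21, ((({1, 4, 10, 13, 16, 19} : Finset (ZMod 21))).filter fun w => c * w ∈ residueSet 21 Φ₃).card =
        ((({1, 4, 10, 13, 16, 19} : Finset (ZMod 21))).filter fun w => c * w ∉ residueSet 21 Φ₃).card) := by
      rw [hr₃]; exact hb₁
    obtain ⟨hS, hd, -⟩ := exists_exceptional_of_cosetBalanced_twentyOne hK Φ₃ φ₀ hp₃ (Or.inl hbal) hA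
    exact ⟨Φ₃, A, ι', θ', hA, hS, hd, hodgeClassSpan_three_ne_twentyOne hK Φ₃ φ₀ hp₃ (Or.inl hbal) hA⟩
  · obtain ⟨A, ι', θ', hA⟩ := Literature.AlgebraicGeometry.ComplexMultiplication.exists_isCMTypeRealisation Φ₁
    have hn := not_cosetBalanced_of_isAutTransform_P_twentyOne (IsAutTransform.refl Φ₁) (Or.inl hr₁)
    exact ⟨Φ₁, A, ι', θ', hA, isSimple_of_isCMTypeRealisation_of_isPrimitive hA φ₀ hp₁, dim_eq_six_of_isCMTypeRealisation_twentyOne hK hA,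
      fun n ↦ hodgeConjectureFor_pow_of_not_cosetBalanced_twentyOne hK Φ₁ φ₀ (fun _ ↦ hn) hA n⟩

end Varieties

/-! ### §3 Complex tori with an endomorphism of characteristic polynomial `Φ₂₁` -/

section Tori

variable {ι : Type} [Fintype ι] [DecidableEq ι] {E : Type} [NormedAddCommGroup E] [NormedSpace ℂ E]
  {P : (ι → ℝ) ≃L[ℝ] E}

set_option backward.isDefEq.respectTransparency false in -- Mathlib's instance
-- `IsCyclotomicExtension {21} ℚ (CyclotomicField 21 ℚ)` is keyed on `CyclotomicField.algebra`, the goal on `DivisionRing.toRatAlgebra`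
/-- **`rank MT(X) = 7` OR `6` FOR A SIMPLE COMPLEX TORUS WITH AN ENDOMORPHISM OF CHARACTERISTIC POLYNOMIAL `Φ₂₁`**: `X ≅ ℂ⁶/Φ(𝔞)` with `Φ`
primitive (structure theorem), `rank MT(X) = Rank(Φ) ∈ {7, 6}` (§1). [cite: Dodson1984, §3.1.0 and Thm. 3.2.1] [cite: Shimura1998, §6.2 Thm. 3] -/
theorem IsSimple.mtRank_hodgeStructure_eq_seven_or_six_twentyOne [HodgeTensorFacts.{0, 0}] (hX : ComplexTorus.IsSimple P)
    {A : Matrix ι ι ℤ} (hA : A ∈ endRingInt P) (hP : A.charpoly = cyclotomic 21 ℤ) :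
    (hodgeStructure P 1).mtRank = 7 ∨ (hodgeStructure P 1).mtRank = 6 := by
  have hζ := IsCyclotomicExtension.zeta_spec 21 ℚ (CyclotomicField 21 ℚ)
  obtain ⟨Φ, I, e, he, he₂, -⟩ := exists_cmType_ideal_iso_of_charpoly_eq_cyclotomic hζ hA hP
  haveI : IsCMField (CyclotomicField 21 ℚ) := isCMField₆₀ (CyclotomicField 21 ℚ)
  obtain ⟨φ₀⟩ : Nonempty (CyclotomicField 21 ℚ →+* ℂ) := inferInstance
  have hXiso : IsIsomorphic P (periodIso Φ I) := ⟨e, he, he₂⟩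
  have hS : ComplexTorus.IsSimple (periodIso Φ I) := hXiso.isSimple_iff.1 hX
  have hΦ : IsPrimitive (ℂ ≃+* ℂ) Φ.1 φ₀ := (isSimple_periodIso_iff_isPrimitive Φ I φ₀).1 hS
  rw [IsIsomorphic.mtRank_hodgeStructure_eq P (periodIso Φ I) (k := 1) hXiso, mtRank_hodgeStructure_periodIso_eq_cmTypeRank Φ I]
  rcases cmTypeRank_eq_seven_or_six_of_isPrimitive_twentyOne Φ φ₀ hΦ with ⟨-, -, h⟩ | ⟨-, h⟩
  · exact Or.inl h
  · exact Or.inr h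

set_option backward.isDefEq.respectTransparency false in -- see above
/-- **FOR A SIMPLE `X` WITH `P_u = Φ₂₁`: `Hdg(Xᵏ) = Div(Xᵏ)` FOR ALL `k` ⟺ `rank MT(X) = 7`** (an abelian variety with a Mumford–Tate torus;
Hazama–Murty's criterion `rank = dim + 1`). [cite: Gordon1999HodgeAVSurvey, 7.5 and §9.3] [cite: MoonenZarhin1999LowDim, §2 Thm. (2.7)] -/
theorem forall_divisorClasses_powPeriod_eq_hodgeClasses_iff_of_isSimple_twentyOne [HodgeTensorFacts.{0, 0}] (hX : ComplexTorus.IsSimple P)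
    {A : Matrix ι ι ℤ} (hA : A ∈ endRingInt P) (hP : A.charpoly = cyclotomic 21 ℤ) :
    (∀ k p : ℕ, divisorClasses (powPeriod P k) p = hodgeClasses (powPeriod P k) p) ↔ (hodgeStructure P 1).mtRank = 7 := by
  have hζ := IsCyclotomicExtension.zeta_spec 21 ℚ (CyclotomicField 21 ℚ)
  obtain ⟨Φ, I, e, he, he₂, -⟩ := exists_cmType_ideal_iso_of_charpoly_eq_cyclotomic hζ hA hP
  haveI : IsCMField (CyclotomicField 21 ℚ) := isCMField₆₀ (CyclotomicField 21 ℚ)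
  have hXiso : IsIsomorphic P (periodIso Φ I) := ⟨e, he, he₂⟩
  have hS : ComplexTorus.IsSimple (periodIso Φ I) := hXiso.isSimple_iff.1 hX
  have hcard : Fintype.card (basisIndex I) = 12 := by rw [card_basisIndex_eq_finrank, finrank_eq_twelve₆₀ (CyclotomicField 21 ℚ)]
  haveI : Nonempty (basisIndex I) := Fintype.card_pos_iff.1 (by omega)
  have hY := isAbelianVariety_periodIso Φ I
  rw [hXiso.isIsogenous.forall_powPeriod_divisorClasses_eq_hodgeClasses_iff,
    hY.forall_powPeriod_divisorClasses_eq_hodgeClasses_iff_mtRank_eq_card_of_isSimple_of_isTorusSubgroup_mumfordTateGroupC hS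
      (isTorusSubgroup_mumfordTateGroupC_periodIso Φ I),
    IsIsomorphic.mtRank_hodgeStructure_eq P (periodIso Φ I) (k := 1) hXiso, hcard]

/-- **`Hdg(Xᵏ) = Div(Xᵏ)` FOR ALL `k` WHEN `X` IS NOT SIMPLE OR `rank MT(X) = 7`** (non-simple: the degree-`≤ 12` theorem; simple of rank `7`: above).
[cite: MoonenZarhin1999LowDim, §2 Thm. (2.7)] [cite: Gordon1999HodgeAVSurvey, 7.5] -/
theorem divisorClasses_powPeriod_eq_hodgeClasses_of_twentyOne [HodgeTensorFacts.{0, 0}] {A : Matrix ι ι ℤ} (hA : A ∈ endRingInt P)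
    (hP : A.charpoly = cyclotomic 21 ℤ) (h : ComplexTorus.IsSimple P → (hodgeStructure P 1).mtRank = 7) (k p : ℕ) :
    divisorClasses (powPeriod P k) p = hodgeClasses (powPeriod P k) p := by
  by_cases hX : ComplexTorus.IsSimple P
  · exact (forall_divisorClasses_powPeriod_eq_hodgeClasses_iff_of_isSimple_twentyOne hX hA hP).2 (h hX) k p
  · have h12 : Nat.totient 21 ≤ 12 := by decide
    exact divisorClasses_powPeriod_eq_hodgeClasses_of_not_isSimple_of_charpoly_eq_cyclotomic_of_totient_le_twelve (by norm_num)
      h12 hX hA hP k p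

set_option backward.isDefEq.respectTransparency false in -- see above
/-- **BOTH CASES OCCUR AMONG ABELIAN VARIETIES.**  (1) For a type `Φ` with residue set `D₁` and any ideal `𝔞`, the torus `X = ℂ⁶/Φ(𝔞)` is a
SIMPLE ABELIAN VARIETY carrying the endomorphism `ζ₂₁` (characteristic polynomial `Φ₂₁`) with `rank MT(X) = 6`, and `Hdg(Xᵏ) ≠ Div(Xᵏ)` in
some degree on some power; (2) for residue set `P₁` the same with `rank MT(X) = 7` and `Hdg(Xᵏ) = Div(Xᵏ)` for all `k`.
[cite: Dodson1984, Thm. 3.2.1] [cite: Shimura1998, §6.2 Thm. 3] [cite: Gordon1999HodgeAVSurvey, 7.5] -/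
theorem exists_isSimple_mtRank_eq_six_and_seven_twentyOne [HodgeTensorFacts.{0, 0}] :
    (∃ Φ : CMType (CyclotomicField 21 ℚ), ∀ I : (FractionalIdeal (𝓞 (CyclotomicField 21 ℚ))⁰ (CyclotomicField 21 ℚ))ˣ,
      ComplexTorus.IsSimple (periodIso Φ I) ∧ IsAbelianVariety (periodIso Φ I) ∧
      (∃ A ∈ endRingInt (periodIso Φ I), A.charpoly = cyclotomic 21 ℤ) ∧
      (hodgeStructure (periodIso Φ I) 1).mtRank = 6 ∧
      ¬ ∀ k p : ℕ, divisorClasses (powPeriod (periodIso Φ I) k) p = hodgeClasses (powPeriod (periodIso Φ I) k) p) ∧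
    (∃ Φ : CMType (CyclotomicField 21 ℚ), ∀ I : (FractionalIdeal (𝓞 (CyclotomicField 21 ℚ))⁰ (CyclotomicField 21 ℚ))ˣ,
      ComplexTorus.IsSimple (periodIso Φ I) ∧ IsAbelianVariety (periodIso Φ I) ∧
      (∃ A ∈ endRingInt (periodIso Φ I), A.charpoly = cyclotomic 21 ℤ) ∧
      (hodgeStructure (periodIso Φ I) 1).mtRank = 7 ∧
      ∀ k p : ℕ, divisorClasses (powPeriod (periodIso Φ I) k) p = hodgeClasses (powPeriod (periodIso Φ I) k) p) := by
  have hζ := IsCyclotomicExtension.zeta_spec 21 ℚ (CyclotomicField 21 ℚ)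
  haveI : IsCMField (CyclotomicField 21 ℚ) := isCMField₆₀ (CyclotomicField 21 ℚ)
  obtain ⟨φ₀⟩ : Nonempty (CyclotomicField 21 ℚ →+* ℂ) := inferInstance
  obtain ⟨Φ₁, -, Φ₃, -, -, -, -, -, hr₁, -, hr₃, -, -, -, -, -, ⟨hp₁, -, hp₃, -⟩, -⟩ :=
    exists_eight_families_twentyOne (L := CyclotomicField 21 ℚ) φ₀
  have hend : ∀ (Φ : CMType (CyclotomicField 21 ℚ)) (I : (FractionalIdeal (𝓞 (CyclotomicField 21 ℚ))⁰ (CyclotomicField 21 ℚ))ˣ),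
      ∃ A ∈ endRingInt (periodIso Φ I), A.charpoly = cyclotomic 21 ℤ :=
    fun Φ I ↦ ⟨Literature.NumberTheory.ComplexMultiplication.CMTypeLattice.mulMatrix I hζ.toInteger,
      mulMatrix_toInteger_mem_endRingInt hζ Φ I, charpoly_mulMatrix_toInteger hζ I⟩
  have hsimple : ∀ {Φ : CMType (CyclotomicField 21 ℚ)}, IsPrimitive (ℂ ≃+* ℂ) Φ.1 φ₀ →
      ∀ I, ComplexTorus.IsSimple (periodIso Φ I) := fun {Φ} hΦ I ↦ (isSimple_periodIso_iff_isPrimitive Φ I φ₀).2 hΦ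
  constructor
  · refine ⟨Φ₃, fun I ↦ ⟨hsimple hp₃ I, isAbelianVariety_periodIso Φ₃ I, hend Φ₃ I, ?_, ?_⟩⟩
    · rw [mtRank_hodgeStructure_periodIso_eq_cmTypeRank Φ₃ I, cmTypeRank_eq_six_of_residueSet_eq_D_twentyOne Φ₃ (Or.inl hr₃)]
    · obtain ⟨A, hA, hP⟩ := hend Φ₃ I
      rw [forall_divisorClasses_powPeriod_eq_hodgeClasses_iff_of_isSimple_twentyOne (hsimple hp₃ I) hA hP,
        mtRank_hodgeStructure_periodIso_eq_cmTypeRank Φ₃ I, cmTypeRank_eq_six_of_residueSet_eq_D_twentyOne Φ₃ (Or.inl hr₃)]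
      omega
  · refine ⟨Φ₁, fun I ↦ ⟨hsimple hp₁ I, isAbelianVariety_periodIso Φ₁ I, hend Φ₁ I, ?_, ?_⟩⟩
    · rw [mtRank_hodgeStructure_periodIso_eq_cmTypeRank Φ₁ I, cmTypeRank_eq_seven_of_residueSet_eq_P_twentyOne Φ₁ (Or.inl hr₁)]
    · obtain ⟨A, hA, hP⟩ := hend Φ₁ I
      rw [forall_divisorClasses_powPeriod_eq_hodgeClasses_iff_of_isSimple_twentyOne (hsimple hp₁ I) hA hP,
        mtRank_hodgeStructure_periodIso_eq_cmTypeRank Φ₁ I, cmTypeRank_eq_seven_of_residueSet_eq_P_twentyOne Φ₁ (Or.inl hr₁)]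

end Tori

end ComplexTorus

end Literature.Geometry.Kaehler

end
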